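import Mathlib
import Summits.CriticalPhenomena.PercolationContinuityZ3.Theses.PercBurnResprinkle
import Literature.Probability.Percolation.PercolationProofs
import Literature.Probability.Percolation.BernoulliPercolationProofs
import Literature.Probability.Percolation.CriticalContinuityProofs

/-!
# Negative lemma for crux `VacantReignition` (stmt-CriticalPhenomena-7203): `¬ StrongTail`

Crux-triage round 1, seat 1 (refuter), card `fkg-shell-chaining` (ideator 1).  The card's transfer
target `StrongTail` (its `C⁺`, file `Cruxes/VacantReignition/SketchIdeator1.lean`, 2026-08-15) asks,
for SOME supercritical level `p > p_c` and all large dyadic scales `2^k m₀`, for a usable radial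
crossing AND a usable SEPARATING SHELL (a connected set of usable blocks in `box(4m) ∖ box(2m)` met by
EVERY lattice walk from `box(2m)` to the `±4m` layer) with probability `≥ 1 - 2^{-k}`.

It is false in every world: the infinite burnt cluster itself pierces every usable shell.  On
`{0 ∈ I_p(U)}` an `ω_p`-open walk from the origin to sup-distance `> 4m` is (block side `a = 1`) a
lattice walk of NON-usable blocks from block `0 ∈ box(2m)` to the `±4m` layer
(`not_mem_shellEvent_of_origin_burnt`), so `μ2.real (radial ∩ shell) ≤ 1 - θ(p')` for every level
`p' ≤ p` in `[0,1]` (`measureReal_shellEvent_le`), and `StrongTail` forces `θ(p') ≤ 2^{-k}` for all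
large `k` at `p' = min p 1 > p_c`, contradicting `θ(p') > 0` (`not_StrongTail`).  Consequently the
card's first lemma `ShellChainLemma` (hypothesis: shells with probability `≥ q > 0` at ALL scales) is
vacuous for `p > p_c`, and the FKG-chaining lever cannot be repaired monotonically (TRIAGE-r1-1.md).

The vocabulary `burnt … shellEvent` below copies the card's (SketchIdeator1.lean) verbatim, with its
`Prop`-valued predicates `usableBlockLoc / radialAt / shellAt` written as `Set`s (`usableBlocks /
radialEvent / shellEvent`, definitional), inlined so that this file imports no crux workfile; the seat's
scratch file `checks/NotStrongTail.lean` (item evidence) proves `¬ Sketch.StrongTail` against the card's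
own declarations by the same script.
-/

noncomputable section

namespace Summit.CriticalPhenomena.PercolationContinuityZ3.Theorems.VacantReignition.Negative.NotStrongTail

open MeasureTheory Literature.Probability.Percolation Literature.Probability.LatticeModels

/-! ## The card's vocabulary (from `Cruxes/VacantReignition/SketchIdeator1.lean`, events as `Set`s) -/

/-- `p_c(ℤ³)` as a real. [folklore] -/
abbrev pc : ℝ := criticalProb (zdGraph 3) (0 : Site 3)

/-- Label pairs `π = (U, U′)`: environment labels `π.1`, fresh/dust labels `π.2`. [folklore] -/
abbrev LabelPair : Type := (Sym2 (Site 3) → ℝ) × (Sym2 (Site 3) → ℝ)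

/-- The law of the pair (environment labels `U`, fresh labels `U'`). [folklore] -/
abbrev μ2 : Measure LabelPair := (labelMeasure (Site 3)).prod (labelMeasure (Site 3))

/-- The burnt set `I_p(U)`: vertices lying in an infinite cluster of `ω_p = {U ≤ p}` (verbatim). [folklore] -/
def burnt (p : ℝ) (U : Sym2 (Site 3) → ℝ) : Set (Site 3) :=
  {y | (openCluster (configOfLabels p U (zdGraph 3)) y).Infinite}

/-- The `3a`-neighbourhood of the block of side `a` indexed by `z ∈ ℤ³` (verbatim). [folklore] -/
def blockNbhd (a : ℕ) (z : Site 3) : Set (Site 3) :=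
  {y | ∀ i, (a : ℤ) * (z i - 1) ≤ y i ∧ y i < (a : ℤ) * (z i + 2)}

/-- The designated dust edge of block `z` (verbatim). [folklore] -/
def dustEdge (a : ℕ) (z : Site 3) : Sym2 (Site 3) :=
  s((a : ℤ) • z, (a : ℤ) • z + Pi.single 0 1)

/-- The `R`-arm set at level `p` (verbatim): vertices joined by an open path to sup-distance `≥ R`;
it contains the burnt set for every `R`. [folklore] -/
def armSet (p : ℝ) (R : ℕ) (U : Sym2 (Site 3) → ℝ) : Set (Site 3) :=
  {y | ∃ z : Site 3, (R : ℝ) ≤ dist y z ∧ (openGraph (configOfLabels p U (zdGraph 3))).Reachable y z}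

/-- The set of USABLE blocks (the card's predicate `usableBlockLoc p R a ρ π`, as a set of block
indices): the `3a`-neighbourhood misses the `R`-arm set and the dust label is `≤ ρ`. [folklore] -/
def usableBlocks (p : ℝ) (R a : ℕ) (ρ : ℝ) (π : LabelPair) : Set (Site 3) :=
  {z | (∀ y ∈ blockNbhd a z, y ∉ armSet p R π.1) ∧ π.2 (dustEdge a z) ≤ ρ}

/-- The block-edge configuration of usable blocks (the card's `usableCfg`). [folklore] -/
def usableCfg (p : ℝ) (R a : ℕ) (ρ : ℝ) (π : LabelPair) : BondConfig (Site 3) :=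
  {E | E ∈ (zdGraph 3).edgeSet ∧ ∀ z ∈ E, z ∈ usableBlocks p R a ρ π}

/-- The event "usable radial crossing of the block annulus at scale `m`" (the card's `radialAt`,
as a set of label pairs). [folklore] -/
def radialEvent (p : ℝ) (R a : ℕ) (ρ : ℝ) (m : ℕ) : Set LabelPair :=
  {π | ∃ z ∈ (box 3 m : Set (Site 3)), ∃ z' : Site 3, (∃ i, z' i = 4 * (m : ℤ) ∨ z' i = -(4 * (m : ℤ))) ∧
    usableCfg p R a ρ π ∈ openConnIn (box 3 (4 * m) : Set (Site 3)) z z'}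

/-- The event "usable separating SHELL at scale `m`" (the card's `shellAt`, as a set of label pairs):
a finite lattice-connected set of usable blocks inside `box 3 (4m) ∖ box 3 (2m)` met by EVERY lattice
walk from `box 3 (2m)` to the `±4m` layer. [folklore] -/
def shellEvent (p : ℝ) (R a : ℕ) (ρ : ℝ) (m : ℕ) : Set LabelPair :=
  {π | ∃ S : Finset (Site 3),
    (∀ s ∈ S, s ∈ usableBlocks p R a ρ π ∧ s ∈ box 3 (4 * m) ∧ s ∉ box 3 (2 * m)) ∧
    ((zdGraph 3).induce (S : Set (Site 3))).Connected ∧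
    ∀ z ∈ (box 3 (2 * m) : Set (Site 3)), ∀ z' : Site 3,
      (∃ i, z' i = 4 * (m : ℤ) ∨ z' i = -(4 * (m : ℤ))) →
        ∀ w : (zdGraph 3).Walk z z', ∃ s ∈ S, s ∈ w.support}

/-! ## Deterministic lemmas -/

/-- A lattice walk of NON-usable blocks from `box 3 (2m)` to the `±4m` layer defeats every usable
separating shell. [folklore] -/
theorem not_mem_shellEvent_of_nonusable_walk (p : ℝ) (R a : ℕ) (ρ : ℝ) (π : LabelPair) (m : ℕ)
    (z z' : Site 3) (hz : z ∈ (box 3 (2 * m) : Set (Site 3)))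
    (hz' : ∃ i, z' i = 4 * (m : ℤ) ∨ z' i = -(4 * (m : ℤ)))
    (w : (zdGraph 3).Walk z z')
    (hw : ∀ s ∈ w.support, s ∉ usableBlocks p R a ρ π) :
    π ∉ shellEvent p R a ρ m := by
  rintro ⟨S, hS, -, hsep⟩
  obtain ⟨s, hsS, hsw⟩ := hsep z hz z' hz' w
  exact hw s hsw (hS s hsS).1

/-- Discrete intermediate value theorem along a lattice walk of `ℤ³`, one coordinate. [folklore] -/
theorem exists_mem_support_apply_eq {u v : Site 3} (w : (zdGraph 3).Walk u v) (i : Fin 3) (c : ℤ)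
    (hu : u i ≤ c) (hv : c ≤ v i) : ∃ s ∈ w.support, s i = c := by
  induction w with
  | nil => exact ⟨_, by simp, le_antisymm hu hv⟩
  | @cons a b _ hadj w ih =>
    by_cases h : a i = c
    · exact ⟨a, by simp, h⟩
    · have hlt : a i < c := lt_of_le_of_ne hu h
      have hb : b i ≤ c := by
        obtain ⟨j, hj | hj⟩ := (zdGraph_adj_iff a b).1 hadj
        · have hbi : b i = a i + (Pi.single j (1 : ℤ) : Site 3) i := by rw [hj]; rfl
          by_cases hji : i = j
          · subst hji; simp at hbi; omega
          · simp [hji] at hbi; omega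
        · have hai : a i = b i + (Pi.single j (1 : ℤ) : Site 3) i := by rw [hj]; rfl
          by_cases hji : i = j
          · subst hji; simp at hai; omega
          · simp [hji] at hai; omega
      obtain ⟨s, hs, hsc⟩ := ih hb hv
      exact ⟨s, by simp [hs], hsc⟩

/-- An infinite subset of `ℤ³` leaves every ball. [folklore] -/
theorem exists_far_of_infinite {S : Set (Site 3)} (hS : S.Infinite) (x : Site 3) (r : ℝ) :
    ∃ z ∈ S, r < dist x z := by
  by_contra h
  push Not at h
  apply hS
  refine Set.Finite.subset (s := Metric.closedBall x r) ?_ (fun z hz => ?_)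
  · exact (isCompact_closedBall x r).finite_of_discrete
  · rw [Metric.mem_closedBall, dist_comm]; exact h z hz

/-- The open graph of `ω_p` is a subgraph of `ℤ³`. [folklore] -/
theorem openGraph_configOfLabels_le (p : ℝ) (U : Sym2 (Site 3) → ℝ) :
    openGraph (configOfLabels p U (zdGraph 3)) ≤ zdGraph 3 := by
  intro a b h
  rw [openGraph_adj] at h
  exact h.1.1

/-- **The burnt origin kills the shell at every scale** (block side `a = 1`): the open walk from
`0 ∈ I_p` to sup-distance `> 4m`, cut at the first vertex with a coordinate `= ±4m`, is a lattice
walk of non-usable blocks (each of its vertices lies in its own `blockNbhd 1` and in `armSet p R`,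
its cluster being infinite). [folklore] -/
theorem not_mem_shellEvent_of_origin_burnt (p : ℝ) (R : ℕ) (ρ : ℝ) (π : LabelPair) (m : ℕ)
    (h0 : (0 : Site 3) ∈ burnt p π.1) : π ∉ shellEvent p R 1 ρ m := by
  have hinf : (openCluster (configOfLabels p π.1 (zdGraph 3)) 0).Infinite := h0
  obtain ⟨z, hz, hzfar⟩ := exists_far_of_infinite hinf 0 (4 * m)
  obtain ⟨w0⟩ : (openGraph (configOfLabels p π.1 (zdGraph 3))).Reachable 0 z := hz
  let w : (zdGraph 3).Walk 0 z := w0.mapLe (openGraph_configOfLabels_le p π.1)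
  have hwsupp : w.support = w0.support := by
    change (w0.map (SimpleGraph.Hom.ofLE _)).support = w0.support
    rw [SimpleGraph.Walk.support_map]
    exact List.map_id _
  have hi : ∃ i, (4 * m : ℤ) < |z i| := by
    by_contra hcon
    push Not at hcon
    have : dist (0 : Site 3) z ≤ 4 * m := by
      rw [dist_pi_le_iff (by positivity)]
      intro i
      rw [dist_comm, Int.dist_eq]
      have := hcon i
      simp only [Pi.zero_apply, Int.cast_zero, sub_zero]
      rw [← Int.cast_abs]
      exact_mod_cast this
    exact absurd hzfar (not_lt.2 this)
  obtain ⟨i, hi⟩ := hi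
  obtain ⟨s, hs, hsi⟩ : ∃ s ∈ w.support, s i = 4 * (m : ℤ) ∨ s i = -(4 * (m : ℤ)) := by
    rcases lt_abs.1 hi with h | h
    · obtain ⟨s, hs, e⟩ := exists_mem_support_apply_eq w i (4 * m) (by simp) h.le
      exact ⟨s, hs, Or.inl e⟩
    · obtain ⟨s, hs, e⟩ :=
        exists_mem_support_apply_eq w.reverse i (-(4 * m)) (by linarith) (by simp)
      exact ⟨s, by simpa using hs, Or.inr e⟩
  refine not_mem_shellEvent_of_nonusable_walk p R 1 ρ π m 0 s
    (by
      have h1 : (0 : ℤ) ≤ 2 * (m : ℤ) := by positivity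
      simp [box, Pi.le_def, h1]) ⟨i, hsi⟩ (w.takeUntil s hs) ?_
  intro t ht hus
  have ht' : t ∈ w.support := w.support_takeUntil_subset_support hs ht
  have ht0 : t ∈ w0.support := hwsupp ▸ ht'
  have htreach : (openGraph (configOfLabels p π.1 (zdGraph 3))).Reachable 0 t :=
    ⟨w0.takeUntil t ht0⟩
  have htinf : (openCluster (configOfLabels p π.1 (zdGraph 3)) t).Infinite := by
    have heq : openCluster (configOfLabels p π.1 (zdGraph 3)) t
        = openCluster (configOfLabels p π.1 (zdGraph 3)) 0 := by
      ext y
      simp only [openCluster, Set.mem_setOf_eq]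
      exact ⟨fun h => htreach.trans h, fun h => htreach.symm.trans h⟩
    rw [heq]; exact hinf
  have htarm : t ∈ armSet p R π.1 := by
    obtain ⟨y, hy, hyfar⟩ := exists_far_of_infinite htinf t R
    exact ⟨y, hyfar.le, hy⟩
  have htn : t ∈ blockNbhd 1 t := by
    intro j
    simp only [Nat.cast_one, one_mul]
    omega
  exact hus.1 t htn htarm

/-- The event inclusion: a usable shell at any scale forces the origin off the burnt set. [folklore] -/
theorem shellEvent_subset (p : ℝ) (R : ℕ) (ρ : ℝ) (m : ℕ) :
    radialEvent p R 1 ρ m ∩ shellEvent p R 1 ρ m ⊆ {π | (0 : Site 3) ∉ burnt p π.1} :=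
  fun π hπ h0 => not_mem_shellEvent_of_origin_burnt p R ρ π m h0 hπ.2

/-- The burnt set is monotone in the level. [folklore] -/
theorem burnt_mono {p p' : ℝ} (h : p' ≤ p) (U : Sym2 (Site 3) → ℝ) : burnt p' U ⊆ burnt p U := by
  intro y hy
  refine Set.Infinite.mono (fun x hx => ?_) hy
  simp only [openCluster, Set.mem_setOf_eq] at hx ⊢
  refine hx.mono ?_
  intro a b hab
  rw [openGraph_adj] at hab ⊢
  exact ⟨configOfLabels_mono U (zdGraph 3) h hab.1, hab.2⟩

/-! ## The measure bound and the refutation -/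

/-- `{U | 0 ∈ I_p(U)}` is measurable. [folklore] -/
theorem measurableSet_zero_mem_burnt (p : ℝ) :
    MeasurableSet {U : Sym2 (Site 3) → ℝ | (0 : Site 3) ∈ burnt p U} :=
  (measurableSet_percolatesAt_holds (0 : Site 3)).preimage (measurable_configOfLabels p (zdGraph 3))

/-- `θ(p) = labelMeasure.real {0 ∈ I_p}` (law of `configOfLabels p` is `P_p`). [folklore] -/
theorem theta_eq_measureReal_zero_mem_burnt (p : unitInterval) :
    theta (zdGraph 3) (0 : Site 3) p
      = (labelMeasure (Site 3)).real {U : Sym2 (Site 3) → ℝ | (0 : Site 3) ∈ burnt p U} := by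
  have h : {U : Sym2 (Site 3) → ℝ | (0 : Site 3) ∈ burnt p U}
      = (fun U => configOfLabels (p : ℝ) U (zdGraph 3)) ⁻¹' percolatesAt 0 := rfl
  rw [h, measureReal_def, ← Measure.map_apply (measurable_configOfLabels _ (zdGraph 3))
    (measurableSet_percolatesAt_holds 0), map_configOfLabels_holds (zdGraph 3) p]
  rfl

/-- `μ2.real {radialAt ∧ shellAt at scale m, level p} ≤ 1 - θ(p')` for every `p' ≤ p` in `[0,1]`. [folklore] -/
theorem measureReal_shellEvent_le (p : ℝ) (p' : unitInterval) (hp : (p' : ℝ) ≤ p) (R : ℕ) (ρ : ℝ) (m : ℕ) :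
    μ2.real (radialEvent p R 1 ρ m ∩ shellEvent p R 1 ρ m)
      ≤ 1 - theta (zdGraph 3) (0 : Site 3) p' := by
  have hI : IsProbabilityMeasure (labelMeasure (Site 3)) := isProbabilityMeasure_labelMeasure (Site 3)
  have hsub : radialEvent p R 1 ρ m ∩ shellEvent p R 1 ρ m
      ⊆ {U : Sym2 (Site 3) → ℝ | (0 : Site 3) ∈ burnt (p' : ℝ) U}ᶜ ×ˢ (Set.univ : Set (Sym2 (Site 3) → ℝ)) := by
    intro π hπ
    refine ⟨?_, Set.mem_univ _⟩
    intro h0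
    exact shellEvent_subset p R ρ m hπ (burnt_mono hp π.1 h0)
  calc μ2.real (radialEvent p R 1 ρ m ∩ shellEvent p R 1 ρ m)
      ≤ μ2.real ({U : Sym2 (Site 3) → ℝ | (0 : Site 3) ∈ burnt (p' : ℝ) U}ᶜ ×ˢ (Set.univ : Set (Sym2 (Site 3) → ℝ))) :=
        measureReal_mono hsub (measure_ne_top _ _)
    _ = (labelMeasure (Site 3)).real {U : Sym2 (Site 3) → ℝ | (0 : Site 3) ∈ burnt (p' : ℝ) U}ᶜ := by
        simp only [measureReal_def, μ2, Measure.prod_prod, measure_univ, mul_one]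
    _ = 1 - (labelMeasure (Site 3)).real {U : Sym2 (Site 3) → ℝ | (0 : Site 3) ∈ burnt (p' : ℝ) U} := by
        rw [measureReal_compl (measurableSet_zero_mem_burnt _), probReal_univ]
    _ = 1 - theta (zdGraph 3) (0 : Site 3) p' := by
        rw [theta_eq_measureReal_zero_mem_burnt p']

/-- **`StrongTail` is false** (in every world).  The negated statement is the card's `StrongTail`
(`Cruxes/VacantReignition/SketchIdeator1.lean`) verbatim, up to reading its predicates `radialAt`,
`shellAt`, `usableBlockLoc` as the sets `radialEvent`, `shellEvent`, `usableBlocks` (definitional):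
for some `ρ < 1` and EVERY block side `a > 0` there would be a level `p > p_c`, a truncation `R` and a
bottom scale `m₀ > 0` with `1 - 2^{-k} ≤ μ2.real (radial ∩ shell at scale 2^k m₀)` for all large `k`.
Its `a = 1` instance at `p' = min p 1 > p_c` contradicts `θ(p') > 0`
(`theta_pos_of_criticalProb_lt_holds`) via `measureReal_shellEvent_le`. [folklore] -/
theorem not_StrongTail :
    ¬ (∃ ρ : ℝ, ρ < 1 ∧ ∀ a : ℕ, 0 < a → ∃ p : ℝ, pc < p ∧ ∃ R m₀ K : ℕ, 0 < m₀ ∧ ∀ k : ℕ, K ≤ k →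
        1 - (2 : ℝ)⁻¹ ^ k
          ≤ μ2.real (radialEvent p R a ρ (2 ^ k * m₀) ∩ shellEvent p R a ρ (2 ^ k * m₀))) := by
  rintro ⟨ρ, -, h⟩
  obtain ⟨p, hpc, R, m₀, K, -, hk⟩ := h 1 one_pos
  have hpc1 : pc < 1 := criticalProb_zd_lt_one (d := 3) (by norm_num)
  have hpc0 : 0 ≤ pc := (criticalProb_mem_Icc _ _).1
  set p' : ℝ := min p 1 with hp'def
  have hp'c : pc < p' := lt_min hpc hpc1
  have hp'I : p' ∈ unitInterval := ⟨hpc0.trans hp'c.le, min_le_right _ _⟩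
  have hθ : 0 < theta (zdGraph 3) (0 : Site 3) ⟨p', hp'I⟩ :=
    theta_pos_of_criticalProb_lt_holds (zdGraph 3) 0 ⟨p', hp'I⟩ hp'c
  obtain ⟨k, hk1⟩ := exists_pow_lt_of_lt_one hθ (by norm_num : (2 : ℝ)⁻¹ < 1)
  have hK : K ≤ max k K := le_max_right _ _
  have hbound := hk (max k K) hK
  have hle := measureReal_shellEvent_le p ⟨p', hp'I⟩ (min_le_left p 1) R ρ (2 ^ max k K * m₀)
  have hpow : (2 : ℝ)⁻¹ ^ max k K ≤ (2 : ℝ)⁻¹ ^ k :=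
    pow_le_pow_of_le_one (by norm_num) (by norm_num) (le_max_left _ _)
  linarith

end Summit.CriticalPhenomena.PercolationContinuityZ3.Theorems.VacantReignition.Negative.NotStrongTail

end
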